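import Literature.Analysis.FluidPDE.TaoCascadeBlowupDynamics
import Literature.Analysis.FluidPDE.TaoCascadeBlowupDynamicsHolds
import Literature.Analysis.FluidPDE.Tao2016AveragedNS.SplitDelayCircuit
import HarnessLib

/-!
# Tao's cascade ODE with the squared modes doubled: the split system (6.0♯)–(6.8♯), its diagonal,
# and the reduction of "no global solution" to an inductive step with asymmetry clauses

T. Tao, *Finite time blowup for an averaged three-dimensional Navier–Stokes equation*, J. Amer.
Math. Soc. **29** (2016) 601–674 = arXiv:1402.0290v3, §6.1 (6.0)–(6.8) and Theorem 6.2, §6.2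
Proposition 6.3 and the paragraph "Let us now see how the above proposition implies Theorem 6.2"
(p. 32), §6.3 Proposition 6.4 [`Tao2016AveragedNS`]. This file is the split ("square-free")
companion of the tree's `TaoCascadeODE.lean` / `TaoCascadeBlowupDynamics.lean`, in the vocabulary of
`Tao2016AveragedNS/SplitDelayCircuit.lean` (`symPart`, `asymPart`, `symCorrection`, `asymField`).

HONEST FRAMING (cell harvest/h2-tao-ladder, rung 1 of a ladder of MODEL equations; RUNG1-HANDOFF h4 =
the dynamics half "R1-b" of rung 1, referee cycle 6 residual G-R1b "joint induction with asymmetry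
clauses"): the object below is the infinite ODE system obeyed — via the split analogue of Tao's
Lemma 4.1, not proved anywhere — by the wavelet coefficients of a solution of the cell's SPLIT cascade
equation (Tao's circuit (6.1)–(6.4) with the modes `X₁, X₃, X₄` of every shell doubled into
swap-pairs), written in the swap-symmetric / antisymmetric coordinates `S = (S_a, b, S_c, S_d)`,
`Z = (Z_a, Z_c, Z_d)` of `SplitDelayCircuit.lean`. NOTHING in this file proves that the split system
has no global solution (that is the cell's open obligation — written out in the quantifier shape of
`TaoCascade.noGlobalODESolution` wherever it occurs, never named as a fact — and here only REDUCED to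
an inductive step); nothing here bears on the Navier–Stokes equations. What IS proved is elementary: the diagonal `Z ≡ 0` of the split system is exactly Tao's
system (6.0)–(6.8), so that (i) the split non-existence statement implies Tao's Theorem 6.2 and
(ii) by the tree's PROVED Theorem 6.2 (`TaoCascade.noGlobalODESolution_holds`) every global solution
of the split system in Tao's parameter regime is genuinely asymmetric; and the last paragraph of
§6.2 / the induction of §6.3 run verbatim for the split system, for ANY family of additional
checkpoint clauses carried along the induction.

## The split system (6.0♯)–(6.8♯)

Per shell `n ∈ ℤ`, seven real amplitudes: the symmetric ones `S 0 n = S_a = (a′+a″)/√2`,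
`S 1 n = b`, `S 2 n = S_c = (c′+c″)/√2`, `S 3 n = S_d = (d′+d″)/√2` and the asymmetries
`Z 0 n = Z_a = (a′-a″)/√2`, `Z 1 n = Z_c`, `Z 2 n = Z_d`; one combined energy `E n` per shell. With
`Λₙ = (1+ε₀)^{5n/2}` and the inter-shell hand-off `(d′,d″)ₙ → (a′,a″)ₙ₊₁` run at the clock `Λₙ₊₁`
exactly as in (6.1)/(6.4), the equations of motion are Tao's (6.1)–(6.4) for `S` PLUS the quadratic
corrections `symCorrection` — `+ε⁻²Z_cZ_d` and `-K Z_{d,n-1}²` in (6.1♯), `-εZ_a² + ε⁻¹K¹⁰Z_c²` in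
(6.2♯), `-ε²e^{-K¹⁰}Z_a²` in (6.3♯), `-ε⁻²Z_aZ_c` in (6.4♯) — and the LINEAR asymmetry equations
`asymField`: (6.Z1) `∂Z_a = Λₙ(εbZ_a + ε²e^{-K¹⁰}S_cZ_a - ε⁻²S_cZ_d + ε⁻²S_dZ_c)`,
(6.Z2) `∂Z_c = -Λₙε⁻¹K¹⁰ b Z_c`, (6.Z3) `∂Z_d = Λₙε⁻²(S_cZ_a - S_aZ_c) + Λₙ₊₁K S_{a,n+1}Z_d`, each up
to the same dissipation-class error `C₁(1+ε₀)^{2n}E_n^{1/2}` as (6.1)–(6.4) (for the `Z`-rows this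
error IS the source of asymmetry: the two copies of a doubled mode dissipate at different rates).
The local energy inequality (6.5♯) has the hand-off fluxes `ΛₙK(S_{d,n-1}² - Z_{d,n-1}²)S_{a,n}` and
`-Λₙ₊₁K(S_{d,n}² - Z_{d,n}²)S_{a,n+1}` (`2d′d″ = S_d² - Z_d²`: the split hand-off is a two-way valve);
the datum (6.6♯) loads both copies of the input mode of shell `n₀` equally, `S_{a,n₀}(0) = 1`,
`Z(0) = 0`, `Eₙ(0) = ½·1_{n=n₀}`; (6.7♯) bounds `Eₙ` below by `½Σ(S²+Z²)`; (6.8♯) switches off the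
shells `n < n₀`. The symbol-by-symbol agreement of these rows with the nine-mode circuit is the
content of `symPart_splitDelayCircuit` / `asymPart_splitDelayCircuit` (unit circuit, `Λ = 1`) and of
the cell's out-of-tree `rung1/SplitCircuitIdentities.lean` (with the two clocks `s = Λₙ`,
`s′ = Λₙ₊₁`); the rotation `(x′,x″) ↦ ((x′+x″)/√2, (x′-x″)/√2)` is orthogonal, so energies and the
error class are those of the seven original coordinates up to the harmless factor `√2` in `C₁`.

## What is proved

* `TaoODESystem.splitODESystem_zero` / `SplitODESystem.taoODESystem_of_zero`: `(S, 0, E)` solves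
  (6.0♯)–(6.8♯) iff `(S, E)` solves (6.0)–(6.8) — the diagonal is Tao's system, literally.
* `noGlobalODESolution_of_split`: the split non-existence statement implies Tao's Theorem 6.2.
* `SplitODESystem.exists_asym_ne_zero`: in the parameter regime of the tree's proved Theorem 6.2, a
  global solution of the split system has `Z_{i,n}(t) ≠ 0` for some `i, n, t ≥ 0`.
* `SplitODESystem.false_of_blowupCheckpoints` (last paragraph of §6.2 for the split system),
  `SplitODESystem.blowupCheckpoints_base` (base case of §6.3), and the generic induction
  `SplitODESystem.false_of_inductiveStep`: if Tao's checkpoint bounds (6.9)–(6.25) on the symmetric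
  amplitudes (`TaoCascade.BlowupCheckpoints`, reused verbatim), TOGETHER WITH an arbitrary family `P N t e`
  of further clauses holding at the datum, can always be extended from level `N` to level `N+1`, then
  there is no global solution; packaged with Tao's quantifier order as
  `noGlobalSplitODESolution_of_splitBlowupDynamicsStep`.

What is NOT here: the choice of the asymmetry clauses `P` and the proof of the inductive step (the
split analogue of Prop. 6.4/6.5, §6.4–6.7 — the cell's open obligation; its one-epoch, circuit-level
ingredients are `SplitDelayCircuitShadowing.lean` / `SplitDelayCircuitChannels.lean`), the split
analogue of Lemma 4.1, and anything about Navier–Stokes.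
-/

noncomputable section

open Set MeasureTheory

namespace Literature.Analysis.FluidPDE.Tao2016AveragedNS

open TaoCascade

/-! ## The split ODE system -/

/-- **The split ODE system (6.0♯)–(6.8♯)**: Tao's system (6.0)–(6.8) of §6.1 (`TaoCascade.TaoODESystem`,
parameters `ε₀, K, ε`, implied constants `C₁, C₂`, initial scale `n₀`) for the swap-symmetric
amplitudes `S 0 n, …, S 3 n = S_a, b, S_c, S_d` of shell `n`, corrected by the quadratic terms
`symCorrection` in the asymmetries `Z 0 n, Z 1 n, Z 2 n = Z_a, Z_c, Z_d`, together with the linear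
asymmetry equations `asymField` (rows (6.Z1)–(6.Z3) of the module docstring), the two-way hand-off
fluxes `K(S_d² - Z_d²)S_a` in the energy inequality, the equal-loading datum `S_{a,n₀}(0) = 1`,
`Z(0) = 0`, and one combined energy `E n ≥ ½Σᵢ(S_{i,n}² + Z_{i,n}²)` per shell. Regularity, a priori
growth (6.0), energy defect (6.7) and the cut-off (6.8) exactly as in `TaoODESystem`. This is the
cell's MODEL object (the doubled circuit of `SplitDelayCircuit.lean` run on Tao's hierarchy of
scales); no claim about it is asserted here. [cite: Tao2016AveragedNS, §6.1 (6.0)–(6.8)] -/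
structure SplitODESystem (ε₀ K ε C₁ C₂ : ℝ) (n₀ : ℤ) (S : Fin 4 → ℤ → ℝ → ℝ)
    (Z : Fin 3 → ℤ → ℝ → ℝ) (E : ℤ → ℝ → ℝ) : Prop where
  /-- `S_{i,n}` is continuously differentiable on `[0,+∞)`. -/
  contDiffOn_S : ∀ i n, ContDiffOn ℝ 1 (S i n) (Ici 0)
  /-- `Z_{i,n}` is continuously differentiable on `[0,+∞)`. -/
  contDiffOn_Z : ∀ i n, ContDiffOn ℝ 1 (Z i n) (Ici 0)
  /-- `E_n` is continuously differentiable on `[0,+∞)`. -/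
  contDiffOn_E : ∀ n, ContDiffOn ℝ 1 (E n) (Ici 0)
  /-- `E_n` takes values in `[0,+∞)`. -/
  nonneg_E : ∀ n t, 0 ≤ t → 0 ≤ E n t
  /-- (6.0♯): a priori regularity of the symmetric amplitudes. -/
  apriori_S : ∀ T : ℝ, 0 < T → ∃ M : ℝ, ∀ t ∈ Icc 0 T, ∀ (i : Fin 4) (n : ℤ),
    (1 + (1 + ε₀) ^ ((10 : ℝ) * n)) * |S i n t| ≤ M
  /-- (6.0♯): a priori regularity of the asymmetries. -/
  apriori_Z : ∀ T : ℝ, 0 < T → ∃ M : ℝ, ∀ t ∈ Icc 0 T, ∀ (i : Fin 3) (n : ℤ),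
    (1 + (1 + ε₀) ^ ((10 : ℝ) * n)) * |Z i n t| ≤ M
  /-- Display after (6.0): a priori regularity of the combined energies. -/
  apriori_E : ∀ T : ℝ, 0 < T → ∃ M : ℝ, ∀ t ∈ Icc 0 T, ∀ n : ℤ,
    (1 + (1 + ε₀) ^ ((10 : ℝ) * n)) * Real.sqrt (E n t) ≤ M
  /-- (6.1♯): `∂S_a = Λₙ(-ε⁻²S_cS_d - εS_ab - ε²e^{-K¹⁰}S_aS_c + K S_{d,n-1}² + ε⁻²Z_cZ_d - K Z_{d,n-1}²) + O(…)`. -/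
  eq1 : ∀ n t, 0 ≤ t →
    |derivWithin (S 0 n) (Ici 0) t - (1 + ε₀) ^ ((5 : ℝ) * n / 2) *
        (-(ε ^ 2)⁻¹ * S 2 n t * S 3 n t - ε * S 0 n t * S 1 n t -
          ε ^ 2 * Real.exp (-K ^ 10) * S 0 n t * S 2 n t + K * S 3 (n - 1) t ^ 2 +
          (ε ^ 2)⁻¹ * Z 1 n t * Z 2 n t - K * Z 2 (n - 1) t ^ 2)| ≤
      C₁ * (1 + ε₀) ^ ((2 : ℝ) * n) * Real.sqrt (E n t)
  /-- (6.2♯): `∂b = Λₙ(εS_a² - ε⁻¹K¹⁰S_c² - εZ_a² + ε⁻¹K¹⁰Z_c²) + O(…)`. -/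
  eq2 : ∀ n t, 0 ≤ t →
    |derivWithin (S 1 n) (Ici 0) t - (1 + ε₀) ^ ((5 : ℝ) * n / 2) *
        (ε * S 0 n t ^ 2 - ε⁻¹ * K ^ 10 * S 2 n t ^ 2 - ε * Z 0 n t ^ 2 +
          ε⁻¹ * K ^ 10 * Z 1 n t ^ 2)| ≤
      C₁ * (1 + ε₀) ^ ((2 : ℝ) * n) * Real.sqrt (E n t)
  /-- (6.3♯): `∂S_c = Λₙ(ε²e^{-K¹⁰}S_a² + ε⁻¹K¹⁰bS_c - ε²e^{-K¹⁰}Z_a²) + O(…)`. -/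
  eq3 : ∀ n t, 0 ≤ t →
    |derivWithin (S 2 n) (Ici 0) t - (1 + ε₀) ^ ((5 : ℝ) * n / 2) *
        (ε ^ 2 * Real.exp (-K ^ 10) * S 0 n t ^ 2 + ε⁻¹ * K ^ 10 * S 1 n t * S 2 n t -
          ε ^ 2 * Real.exp (-K ^ 10) * Z 0 n t ^ 2)| ≤
      C₁ * (1 + ε₀) ^ ((2 : ℝ) * n) * Real.sqrt (E n t)
  /-- (6.4♯): `∂S_d = Λₙ(ε⁻²S_cS_a - (1+ε₀)^{5/2}K S_dS_{a,n+1} - ε⁻²Z_aZ_c) + O(…)`. -/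
  eq4 : ∀ n t, 0 ≤ t →
    |derivWithin (S 3 n) (Ici 0) t - (1 + ε₀) ^ ((5 : ℝ) * n / 2) *
        ((ε ^ 2)⁻¹ * S 2 n t * S 0 n t -
          (1 + ε₀) ^ ((5 : ℝ) / 2) * K * S 3 n t * S 0 (n + 1) t -
          (ε ^ 2)⁻¹ * Z 0 n t * Z 1 n t)| ≤
      C₁ * (1 + ε₀) ^ ((2 : ℝ) * n) * Real.sqrt (E n t)
  /-- (6.Z1): `∂Z_a = Λₙ(εbZ_a + ε²e^{-K¹⁰}S_cZ_a - ε⁻²S_cZ_d + ε⁻²S_dZ_c) + O(…)`. -/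
  eqZ1 : ∀ n t, 0 ≤ t →
    |derivWithin (Z 0 n) (Ici 0) t - (1 + ε₀) ^ ((5 : ℝ) * n / 2) *
        (ε * S 1 n t * Z 0 n t + ε ^ 2 * Real.exp (-K ^ 10) * S 2 n t * Z 0 n t -
          (ε ^ 2)⁻¹ * S 2 n t * Z 2 n t + (ε ^ 2)⁻¹ * S 3 n t * Z 1 n t)| ≤
      C₁ * (1 + ε₀) ^ ((2 : ℝ) * n) * Real.sqrt (E n t)
  /-- (6.Z2): `∂Z_c = -Λₙε⁻¹K¹⁰ b Z_c + O(…)`. -/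
  eqZ2 : ∀ n t, 0 ≤ t →
    |derivWithin (Z 1 n) (Ici 0) t - (1 + ε₀) ^ ((5 : ℝ) * n / 2) *
        (-(ε⁻¹ * K ^ 10 * S 1 n t * Z 1 n t))| ≤
      C₁ * (1 + ε₀) ^ ((2 : ℝ) * n) * Real.sqrt (E n t)
  /-- (6.Z3): `∂Z_d = Λₙ(ε⁻²S_cZ_a - ε⁻²S_aZ_c + (1+ε₀)^{5/2}K S_{a,n+1}Z_d) + O(…)`. -/
  eqZ3 : ∀ n t, 0 ≤ t →
    |derivWithin (Z 2 n) (Ici 0) t - (1 + ε₀) ^ ((5 : ℝ) * n / 2) *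
        ((ε ^ 2)⁻¹ * S 2 n t * Z 0 n t - (ε ^ 2)⁻¹ * S 0 n t * Z 1 n t +
          (1 + ε₀) ^ ((5 : ℝ) / 2) * K * S 0 (n + 1) t * Z 2 n t)| ≤
      C₁ * (1 + ε₀) ^ ((2 : ℝ) * n) * Real.sqrt (E n t)
  /-- (6.5♯): the local energy inequality with the two-way hand-off fluxes `K(S_d² - Z_d²)S_a`. -/
  energy : ∀ n t, 0 ≤ t →
    derivWithin (E n) (Ici 0) t ≤
      (1 + ε₀) ^ ((5 : ℝ) * n / 2) * K * (S 3 (n - 1) t ^ 2 - Z 2 (n - 1) t ^ 2) * S 0 n t -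
        (1 + ε₀) ^ ((5 : ℝ) * (n + 1) / 2) * K * (S 3 n t ^ 2 - Z 2 n t ^ 2) * S 0 (n + 1) t
  /-- (6.6♯), energies: `E_n(0) = ½ · 1_{n = n₀}`. -/
  init_E : ∀ n, E n 0 = if n = n₀ then 1 / 2 else 0
  /-- (6.6♯), symmetric amplitudes: `S_{i,n}(0) = 1_{(i,n) = (a,n₀)}` (both copies of the input
  mode of shell `n₀` loaded equally, `a′ = a″ = 1/√2`). -/
  init_S : ∀ i n, S i n 0 = if i = 0 ∧ n = n₀ then 1 else 0
  /-- (6.6♯), asymmetries: `Z_{i,n}(0) = 0`. -/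
  init_Z : ∀ i n, Z i n 0 = 0
  /-- (6.7♯), lower bound: `½Σᵢ(S_{i,n}² + Z_{i,n}²) ≤ E_n`. -/
  defect_lower : ∀ n t, 0 ≤ t → (1 / 2) * (∑ i, S i n t ^ 2 + ∑ i, Z i n t ^ 2) ≤ E n t
  /-- (6.7♯), upper bound, with implied constant `C₂`. -/
  defect_upper : ∀ n t, 0 ≤ t →
    E n t ≤ (1 / 2) * (∑ i, S i n t ^ 2 + ∑ i, Z i n t ^ 2) +
      C₂ * (1 + ε₀) ^ ((2 : ℝ) * n) * ∫ s in (0 : ℝ)..t, E n s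
  /-- (6.8♯): no very low frequencies, energies. -/
  noLow_E : ∀ n t, n < n₀ → 0 ≤ t → E n t = 0
  /-- (6.8♯): no very low frequencies, symmetric amplitudes. -/
  noLow_S : ∀ i n t, n < n₀ → 0 ≤ t → S i n t = 0
  /-- (6.8♯): no very low frequencies, asymmetries. -/
  noLow_Z : ∀ i n t, n < n₀ → 0 ≤ t → Z i n t = 0

/-- **The rows of (6.1♯)–(6.4♯), (6.Z1)–(6.Z3) ARE the circuit's exact `(S, Y)`-reduction.** With
the shell's symmetric state `S = (S_a, b, S_c, S_d, q·S_{a,n+1})` — the next input read at the clock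
ratio `q = Λₙ₊₁/Λₙ = (1+ε₀)^{5/2}` — its asymmetries `Y = (Z_a, Z_c, Z_d, ·)`, and the previous
shell's `(Sm, Ym)`, the bracketed right-hand sides of `SplitODESystem.eq1 … eqZ3` are, row by row,
`delayCircuit K ε S + symCorrection K ε Y` (rows `a, b, c, d`; the incoming hand-off of row `a` is row
`ã` of the previous shell) and `asymField K ε S Y` (rows `Z_a, Z_c, Z_d`) of `SplitDelayCircuit.lean`
(`symPart_splitDelayCircuit`, `asymPart_splitDelayCircuit`). This pins the transcription of the
split table to the kernel-checked nine-mode algebra. [cite: Tao2016AveragedNS, §6.1 (6.1)–(6.4)] -/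
theorem splitSystem_rhs_eq_circuit (K ε q : ℝ) (Sa b Sc Sd Sap Za Zc Zd w : ℝ)
    (Sm : Fin 5 → ℝ) (Ym : Fin 4 → ℝ) :
    let S : Fin 5 → ℝ := ![Sa, b, Sc, Sd, q * Sap]
    let Y : Fin 4 → ℝ := ![Za, Zc, Zd, w]
    (-(ε ^ 2)⁻¹ * Sc * Sd - ε * Sa * b - ε ^ 2 * Real.exp (-K ^ 10) * Sa * Sc + K * Sm 3 ^ 2 +
          (ε ^ 2)⁻¹ * Zc * Zd - K * Ym 2 ^ 2 =
        (delayCircuit K ε S + symCorrection K ε Y) 0 +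
          (delayCircuit K ε Sm + symCorrection K ε Ym) 4) ∧
      (ε * Sa ^ 2 - ε⁻¹ * K ^ 10 * Sc ^ 2 - ε * Za ^ 2 + ε⁻¹ * K ^ 10 * Zc ^ 2 =
        (delayCircuit K ε S + symCorrection K ε Y) 1) ∧
      (ε ^ 2 * Real.exp (-K ^ 10) * Sa ^ 2 + ε⁻¹ * K ^ 10 * b * Sc -
          ε ^ 2 * Real.exp (-K ^ 10) * Za ^ 2 =
        (delayCircuit K ε S + symCorrection K ε Y) 2) ∧
      ((ε ^ 2)⁻¹ * Sc * Sa - q * K * Sd * Sap - (ε ^ 2)⁻¹ * Za * Zc =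
        (delayCircuit K ε S + symCorrection K ε Y) 3) ∧
      (ε * b * Za + ε ^ 2 * Real.exp (-K ^ 10) * Sc * Za - (ε ^ 2)⁻¹ * Sc * Zd +
          (ε ^ 2)⁻¹ * Sd * Zc = asymField K ε S Y 0) ∧
      (-(ε⁻¹ * K ^ 10 * b * Zc) = asymField K ε S Y 1) ∧
      ((ε ^ 2)⁻¹ * Sc * Za - (ε ^ 2)⁻¹ * Sa * Zc + q * K * Sap * Zd = asymField K ε S Y 2) := by
  simp only
  refine ⟨?_, ?_, ?_, ?_, ?_, ?_, ?_⟩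
  · simp [delayCircuit, symCorrection]; ring
  · simp [delayCircuit, symCorrection]; ring
  · simp [delayCircuit, symCorrection]; ring
  · simp [delayCircuit, symCorrection]; ring
  · dsimp only [asymField, Matrix.cons_val]
  · dsimp only [asymField, Matrix.cons_val]
  · dsimp only [asymField, Matrix.cons_val]; ring

/-! ## The diagonal `Z ≡ 0` is Tao's system (6.0)–(6.8), literally -/

section Diagonal

variable {ε₀ K ε C₁ C₂ : ℝ} {n₀ : ℤ} {S : Fin 4 → ℤ → ℝ → ℝ} {E : ℤ → ℝ → ℝ}

/-- **Tao's system embeds as the diagonal of the split system**: if `(X, E)` obeys (6.0)–(6.8) then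
`(X, 0, E)` obeys (6.0♯)–(6.8♯) — every correction and every asymmetry row vanishes at `Z = 0`
(`symCorrection_zero`, `asymField_zero` at the circuit level). [cite: Tao2016AveragedNS, §6.1 (6.0)–(6.8)] -/
theorem _root_.Literature.Analysis.FluidPDE.TaoCascade.TaoODESystem.splitODESystem_zero
    (h : TaoODESystem ε₀ K ε C₁ C₂ n₀ S E) :
    SplitODESystem ε₀ K ε C₁ C₂ n₀ S (fun _ _ _ => 0) E where
  contDiffOn_S := h.contDiffOn_X
  contDiffOn_Z _ _ := contDiffOn_const
  contDiffOn_E := h.contDiffOn_E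
  nonneg_E := h.nonneg_E
  apriori_S := h.apriori_X
  apriori_Z T _ := ⟨0, fun t _ i n => by simp⟩
  apriori_E := h.apriori_E
  eq1 n t ht := by simpa using h.eq1 n t ht
  eq2 n t ht := by simpa using h.eq2 n t ht
  eq3 n t ht := by simpa using h.eq3 n t ht
  eq4 n t ht := by simpa using h.eq4 n t ht
  eqZ1 n t ht := by
    simpa [derivWithin_fun_const] using (abs_nonneg _).trans (h.eq1 n t ht)
  eqZ2 n t ht := by
    simpa [derivWithin_fun_const] using (abs_nonneg _).trans (h.eq1 n t ht)
  eqZ3 n t ht := by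
    simpa [derivWithin_fun_const] using (abs_nonneg _).trans (h.eq1 n t ht)
  energy n t ht := by simpa using h.energy n t ht
  init_E := h.init_E
  init_S := h.init_X
  init_Z _ _ := rfl
  defect_lower n t ht := by simpa using h.defect_lower n t ht
  defect_upper n t ht := by simpa using h.defect_upper n t ht
  noLow_E := h.noLow_E
  noLow_S := h.noLow_X
  noLow_Z _ _ _ _ _ := rfl

/-- **Conversely, a split solution with no asymmetry is a solution of Tao's system.**
[cite: Tao2016AveragedNS, §6.1 (6.0)–(6.8)] -/
theorem SplitODESystem.taoODESystem_of_zero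
    (h : SplitODESystem ε₀ K ε C₁ C₂ n₀ S (fun _ _ _ => 0) E) :
    TaoODESystem ε₀ K ε C₁ C₂ n₀ S E where
  contDiffOn_X := h.contDiffOn_S
  contDiffOn_E := h.contDiffOn_E
  nonneg_E := h.nonneg_E
  apriori_X := h.apriori_S
  apriori_E := h.apriori_E
  eq1 n t ht := by simpa using h.eq1 n t ht
  eq2 n t ht := by simpa using h.eq2 n t ht
  eq3 n t ht := by simpa using h.eq3 n t ht
  eq4 n t ht := by simpa using h.eq4 n t ht
  energy n t ht := by simpa using h.energy n t ht
  init_E := h.init_E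
  init_X := h.init_S
  defect_lower n t ht := by simpa using h.defect_lower n t ht
  defect_upper n t ht := by simpa using h.defect_upper n t ht
  noLow_E := h.noLow_E
  noLow_X := h.noLow_S

end Diagonal

/-- **"No global solution for the split system" implies Tao's Theorem 6.2** (with the same
thresholds): a global solution of (6.0)–(6.8) would sit on the diagonal of the split system. The
hypothesis is the split analogue of `TaoCascade.noGlobalODESolution` (same quantifier shape: `K`
large depending on `ε₀`, `ε` small depending on `ε₀, K`, `n₀` large depending on `ε₀, K, ε, C₁, C₂`) —
the cell's open obligation, written out rather than named. [cite: Tao2016AveragedNS, §6.1 Thm. 6.2] -/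
theorem noGlobalODESolution_of_split
    (h : ∀ ε₀ : ℝ, 0 < ε₀ → ε₀ < 1 →
      ∃ K₀ : ℝ, ∀ K : ℝ, K₀ ≤ K → 0 < K →
        ∃ e₀ : ℝ, 0 < e₀ ∧ ∀ ε : ℝ, 0 < ε → ε ≤ e₀ →
          ∀ C₁ C₂ : ℝ, 0 ≤ C₁ → 0 ≤ C₂ →
            ∃ N₀ : ℤ, ∀ n₀ : ℤ, N₀ ≤ n₀ →
              ¬ ∃ (S : Fin 4 → ℤ → ℝ → ℝ) (Z : Fin 3 → ℤ → ℝ → ℝ) (E : ℤ → ℝ → ℝ),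
                SplitODESystem ε₀ K ε C₁ C₂ n₀ S Z E) :
    noGlobalODESolution := by
  intro ε₀ hε₀ hε₀1
  obtain ⟨K₀, hK⟩ := h ε₀ hε₀ hε₀1
  refine ⟨K₀, fun K hK₀K hKpos => ?_⟩
  obtain ⟨e₀, he₀, hε⟩ := hK K hK₀K hKpos
  refine ⟨e₀, he₀, fun ε hεpos hεle C₁ C₂ hC₁ hC₂ => ?_⟩
  obtain ⟨N₀, hN⟩ := hε ε hεpos hεle C₁ C₂ hC₁ hC₂
  refine ⟨N₀, fun n₀ hn₀ => ?_⟩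
  rintro ⟨X, E, hsol⟩
  exact hN n₀ hn₀ ⟨X, _, E, hsol.splitODESystem_zero⟩

/-- **In Tao's regime a global split solution is genuinely asymmetric (PROVED, from the tree's
Theorem 6.2).** For `0 < ε₀ < 1` there is `K₀` such that for `K ≥ K₀`, `K > 0`, there is `e₀ > 0`
such that for `0 < ε ≤ e₀` and all `C₁, C₂ ≥ 0` there is `N₀` such that for `n₀ ≥ N₀`: every
`(S, Z, E)` obeying (6.0♯)–(6.8♯) has `Z_{i,n}(t) ≠ 0` for some `i, n` and some `t ≥ 0` — the
diagonal carries no global solution, by `TaoCascade.noGlobalODESolution_holds`.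
[cite: Tao2016AveragedNS, §6.1 Thm. 6.2] -/
theorem SplitODESystem.exists_asym_ne_zero :
    ∀ ε₀ : ℝ, 0 < ε₀ → ε₀ < 1 →
      ∃ K₀ : ℝ, ∀ K : ℝ, K₀ ≤ K → 0 < K →
        ∃ e₀ : ℝ, 0 < e₀ ∧ ∀ ε : ℝ, 0 < ε → ε ≤ e₀ →
          ∀ C₁ C₂ : ℝ, 0 ≤ C₁ → 0 ≤ C₂ →
            ∃ N₀ : ℤ, ∀ n₀ : ℤ, N₀ ≤ n₀ →
              ∀ (S : Fin 4 → ℤ → ℝ → ℝ) (Z : Fin 3 → ℤ → ℝ → ℝ) (E : ℤ → ℝ → ℝ),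
                SplitODESystem ε₀ K ε C₁ C₂ n₀ S Z E → ∃ i n t, 0 ≤ t ∧ Z i n t ≠ 0 := by
  intro ε₀ hε₀ hε₀1
  obtain ⟨K₀, hK⟩ := noGlobalODESolution_holds ε₀ hε₀ hε₀1
  refine ⟨K₀, fun K hK₀K hKpos => ?_⟩
  obtain ⟨e₀, he₀, hε⟩ := hK K hK₀K hKpos
  refine ⟨e₀, he₀, fun ε hεpos hεle C₁ C₂ hC₁ hC₂ => ?_⟩
  obtain ⟨N₀, hN⟩ := hε ε hεpos hεle C₁ C₂ hC₁ hC₂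
  refine ⟨N₀, fun n₀ hn₀ S Z E hsol => ?_⟩
  by_contra hZ
  push Not at hZ
  -- off `[0,∞)` the system constrains nothing, so replace `Z` by `0` there as well
  have hsol0 : SplitODESystem ε₀ K ε C₁ C₂ n₀ S (fun _ _ _ => 0) E := by
    have hZ0 : ∀ i n t, 0 ≤ t → Z i n t = 0 := fun i n t ht => hZ i n t ht
    refine
      { contDiffOn_S := hsol.contDiffOn_S
        contDiffOn_Z := fun _ _ => contDiffOn_const
        contDiffOn_E := hsol.contDiffOn_E
        nonneg_E := hsol.nonneg_E
        apriori_S := hsol.apriori_S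
        apriori_Z := fun T _ => ⟨0, fun t _ i n => by simp⟩
        apriori_E := hsol.apriori_E
        eq1 := fun n t ht => by simpa [hZ0 _ _ t ht] using hsol.eq1 n t ht
        eq2 := fun n t ht => by simpa [hZ0 _ _ t ht] using hsol.eq2 n t ht
        eq3 := fun n t ht => by simpa [hZ0 _ _ t ht] using hsol.eq3 n t ht
        eq4 := fun n t ht => by simpa [hZ0 _ _ t ht] using hsol.eq4 n t ht
        eqZ1 := fun n t ht => ?_
        eqZ2 := fun n t ht => ?_
        eqZ3 := fun n t ht => ?_
        energy := fun n t ht => by simpa [hZ0 _ _ t ht] using hsol.energy n t ht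
        init_E := hsol.init_E
        init_S := hsol.init_S
        init_Z := fun _ _ => rfl
        defect_lower := fun n t ht => by simpa [hZ0 _ _ t ht] using hsol.defect_lower n t ht
        defect_upper := fun n t ht => by simpa [hZ0 _ _ t ht] using hsol.defect_upper n t ht
        noLow_E := hsol.noLow_E
        noLow_S := hsol.noLow_S
        noLow_Z := fun _ _ _ _ _ => rfl }
    all_goals
      have hC : 0 ≤ C₁ * (1 + ε₀) ^ ((2 : ℝ) * n) * Real.sqrt (E n t) :=
        (abs_nonneg _).trans (hsol.eq1 n t ht)
      simpa [derivWithin_fun_const, hZ0 _ _ t ht] using hC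
  exact hN n₀ hn₀ ⟨S, E, hsol0.taoODESystem_of_zero⟩

/-! ## Theorem 6.2♯ from checkpoint bounds: the last paragraph of §6.2 for the split system -/

section Checkpoints

variable {ε₀ K ε C₁ C₂ : ℝ} {n₀ : ℤ} {S : Fin 4 → ℤ → ℝ → ℝ} {Z : Fin 3 → ℤ → ℝ → ℝ}
  {E : ℤ → ℝ → ℝ}

/-- **The last paragraph of Tao's §6.2 for the split system, pointwise in the parameters**: if
`(S, Z, E)` obeys (6.0♯)–(6.8♯) and Tao's blow-up checkpoint bounds (6.9)–(6.25)
(`TaoCascade.BlowupCheckpoints`, read on the SYMMETRIC amplitudes `S` and the energies `E`) hold up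
to every level `N ≥ n₀`, contradiction: the lifespans sum to `t_N ≤ T(ε₀, n₀)` uniformly in `N`
while `S_{a,N}(t_N) = e_N ≥ (1+ε₀)^{-(N-n₀)/100}`, against the a priori bound (6.0♯).
[cite: Tao2016AveragedNS, §6.2 p. 32] -/
theorem SplitODESystem.false_of_blowupCheckpoints (hε₀ : 0 < ε₀)
    (hsol : SplitODESystem ε₀ K ε C₁ C₂ n₀ S Z E)
    (hdyn : ∀ N : ℤ, n₀ ≤ N → ∃ t e : ℤ → ℝ, BlowupCheckpoints ε₀ K ε n₀ N S E t e) : False := by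
  have hq1 : (1 : ℝ) < 1 + ε₀ := by linarith
  have hq0 : (0 : ℝ) < 1 + ε₀ := by linarith
  have hρ : (1 + ε₀) ^ (-(249 : ℝ) / 100) < 1 :=
    Real.rpow_lt_one_of_one_lt_of_neg hq1 (by norm_num)
  -- the uniform time horizon
  set T : ℝ := 100 * (1 + ε₀) ^ (-(5 : ℝ) * n₀ / 2) / (1 - (1 + ε₀) ^ (-(249 : ℝ) / 100)) + 1
    with hT
  have hTpos : 0 < T := by
    have : 0 ≤ 100 * (1 + ε₀) ^ (-(5 : ℝ) * n₀ / 2) / (1 - (1 + ε₀) ^ (-(249 : ℝ) / 100)) :=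
      div_nonneg (by positivity) (by linarith)
    linarith
  obtain ⟨M, hM⟩ := hsol.apriori_S T hTpos
  -- `M` bounds `(1+q^{10N}) e_N ≥ q^{(999/100) N + n₀/100}` for every `N ≥ n₀`
  have hbound : ∀ N : ℤ, n₀ ≤ N → (1 + ε₀) ^ ((999 : ℝ) / 100 * N + n₀ / 100) ≤ M := by
    intro N hN
    obtain ⟨t, e, h⟩ := hdyn N hN
    obtain ⟨ht0, htT⟩ := h.time_le_uniform hε₀ hN le_rfl
    have hst := h.state N hN le_rfl
    have hMN := hM (t N) ⟨ht0, by linarith⟩ 0 N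
    rw [hst.x1_eq, abs_of_pos hst.pos] at hMN
    have heN := h.rpow_le_amp hε₀ hN le_rfl
    calc (1 + ε₀) ^ ((999 : ℝ) / 100 * N + n₀ / 100)
        = (1 + ε₀) ^ ((10 : ℝ) * N) * (1 + ε₀) ^ (-((N : ℝ) - n₀) / 100) := by
          have hexp : (999 : ℝ) / 100 * N + n₀ / 100 = (10 : ℝ) * N + -((N : ℝ) - n₀) / 100 := by
            ring
          rw [hexp, Real.rpow_add hq0]
      _ ≤ (1 + (1 + ε₀) ^ ((10 : ℝ) * N)) * e N := by
          apply mul_le_mul _ heN (Real.rpow_pos_of_pos hq0 _).le (by positivity)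
          linarith [Real.rpow_pos_of_pos hq0 ((10 : ℝ) * N)]
      _ ≤ M := hMN
  -- choose `N` so large that the left side exceeds `M` (Bernoulli: `1 + p ε₀ ≤ (1+ε₀)^p`)
  obtain ⟨N, hN⟩ : ∃ N : ℤ, n₀ ≤ N ∧ (max 1 (M / ε₀) + 1 : ℝ) ≤ (999 : ℝ) / 100 * N + n₀ / 100 := by
    obtain ⟨N, hN⟩ := exists_int_gt (max (n₀ : ℝ) ((max 1 (M / ε₀) + 1 - n₀ / 100) * 100 / 999))
    refine ⟨N, ?_, ?_⟩
    · exact_mod_cast ((le_max_left _ _).trans_lt hN).le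
    · have := (le_max_right _ _).trans_lt hN
      nlinarith
  have hp : (1 : ℝ) ≤ (999 : ℝ) / 100 * N + n₀ / 100 := by
    linarith [le_max_left (1 : ℝ) (M / ε₀)]
  have hbern := one_add_mul_self_le_rpow_one_add (s := ε₀) (by linarith) hp
  have hle := hbound N hN.1
  have hMε : M < ((999 : ℝ) / 100 * N + n₀ / 100) * ε₀ := by
    have h2 : M / ε₀ < (999 : ℝ) / 100 * N + n₀ / 100 := by
      linarith [le_max_right (1 : ℝ) (M / ε₀)]
    rwa [div_lt_iff₀ hε₀] at h2
  linarith

/-- **Base case of the induction of §6.3 for the split system**: `t_{n₀} = 0`, `e_{n₀} = 1`; all of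
(6.13)–(6.18) at `n = n₀` follow from the datum (6.6♯) read on the symmetric amplitudes.
[cite: Tao2016AveragedNS, §6.3 p. 32] -/
theorem SplitODESystem.blowupCheckpoints_base (hsol : SplitODESystem ε₀ K ε C₁ C₂ n₀ S Z E)
    (hε₀ : 0 < ε₀) (hK : 0 < K) (hε : 0 < ε) :
    BlowupCheckpoints ε₀ K ε n₀ n₀ S E (fun _ => 0) (fun _ => 1) where
  t_init := rfl
  e_init := rfl
  state n hn hn' := by
    obtain rfl : n = n₀ := le_antisymm hn' hn
    refine ⟨one_pos, by simp [hsol.init_S], ?_, ?_, ?_, ?_, ?_⟩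
    · simp [hsol.init_S]; positivity
    · simp [hsol.init_S]; positivity
    · simp [hsol.init_S]; positivity
    · simp [hsol.init_S]; positivity
    · simp [hsol.init_E]; positivity
  step n hn hn' := absurd hn' (not_le.mpr hn)

/-- **The induction of §6.3 for the split system, with an arbitrary family of extra checkpoint
clauses (PROVED).** Fix a split solution and any predicate `P N t e` on levels, checkpoint times and
amplitudes (the asymmetry clauses of the cell's inductive step live here: smallness of
`Z_{·,N}(t_N)`, `Z_{·,N-1}(t_N)`, of the dormant shells' asymmetries and clocks, …). If `P` holds at
the datum (`t ≡ 0`, `e ≡ 1`, level `n₀`) and every level `N ≥ n₀` carrying Tao's checkpoint bounds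
(6.9)–(6.25) on `(S, E)` AND `P N` can be extended by a pair `(t_{N+1}, e_{N+1})` to level `N+1`
(Prop. 6.4's conclusion `StateBounds ∧ StepBounds` on `(S, E)`, and `P (N+1)`), then the solution
cannot exist. [cite: Tao2016AveragedNS, §6.3 p. 32] -/
theorem SplitODESystem.false_of_inductiveStep (hsol : SplitODESystem ε₀ K ε C₁ C₂ n₀ S Z E)
    (hε₀ : 0 < ε₀) (hK : 0 < K) (hε : 0 < ε) (P : ℤ → (ℤ → ℝ) → (ℤ → ℝ) → Prop)
    (hbase : P n₀ (fun _ => 0) (fun _ => 1))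
    (hstep : ∀ N : ℤ, n₀ ≤ N → ∀ t e : ℤ → ℝ, BlowupCheckpoints ε₀ K ε n₀ N S E t e → P N t e →
      ∃ s a : ℝ, StateBounds ε₀ K ε n₀ S E (N + 1) s a ∧
        StepBounds ε₀ K ε S E (N + 1) (t N) s (e N) a ∧
        P (N + 1) (Function.update t (N + 1) s) (Function.update e (N + 1) a)) : False := by
  refine hsol.false_of_blowupCheckpoints hε₀ fun N hNn => ?_
  -- strengthen the induction with the invariant `P`
  suffices h : ∃ t e : ℤ → ℝ, BlowupCheckpoints ε₀ K ε n₀ N S E t e ∧ P N t e by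
    obtain ⟨t, e, hce, -⟩ := h
    exact ⟨t, e, hce⟩
  induction N, hNn using Int.leInduction with
  | base => exact ⟨_, _, hsol.blowupCheckpoints_base hε₀ hK hε, hbase⟩
  | succ N hmn ih =>
    obtain ⟨t, e, hce, hP⟩ := ih
    obtain ⟨s, a, hst, hsp, hP'⟩ := hstep N hmn t e hce hP
    exact ⟨_, _, hce.extend hmn hst hsp, hP'⟩

end Checkpoints

/-! ## The inductive step as a named proposition, and Theorem 6.2♯ from it -/

/-- **The split analogue of Tao's Proposition 6.4 (blow-up dynamics, inductive case), relative to a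
family `P` of asymmetry clauses — the cell's OBLIGATION, not a printed result and NOT asserted.**
`P ε₀ K ε n₀ S Z E N t e` are the extra checkpoint clauses at level `N` (a parameter: which clauses on
the asymmetries `Z` and on the dormant shells make the step provable is exactly what the cell's h4
must decide). The proposition: in Tao's parameter regime (`0 < ε₀ < 1`, `K ≥ K₀(ε₀)`,
`0 < ε ≤ e₀(ε₀,K)`, `C₁, C₂ ≥ 0`, `n₀ ≥ N₀(ε₀,K,ε,C₁,C₂)`), for every `(S, Z, E)` obeying
(6.0♯)–(6.8♯), every `N ≥ n₀` and all checkpoint data `t, e` with Tao's (6.9)–(6.25) on `(S, E)`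
up to level `N` and `P … N t e`, there are `t_{N+1} > t_N` and `e_{N+1} > 0` with (6.26)–(6.40) on
`(S, E)` (`StateBounds ∧ StepBounds`) and `P … (N+1)` at the updated data.
[cite: Tao2016AveragedNS, §6.3 Prop. 6.4] -/
def splitBlowupDynamicsStep
    (P : ℝ → ℝ → ℝ → ℤ → (Fin 4 → ℤ → ℝ → ℝ) → (Fin 3 → ℤ → ℝ → ℝ) → (ℤ → ℝ → ℝ) →
      ℤ → (ℤ → ℝ) → (ℤ → ℝ) → Prop) : Prop :=
  ∀ ε₀ : ℝ, 0 < ε₀ → ε₀ < 1 →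
    ∃ K₀ : ℝ, ∀ K : ℝ, K₀ ≤ K → 0 < K →
      ∃ e₀ : ℝ, 0 < e₀ ∧ ∀ ε : ℝ, 0 < ε → ε ≤ e₀ →
        ∀ C₁ C₂ : ℝ, 0 ≤ C₁ → 0 ≤ C₂ →
          ∃ N₀ : ℤ, ∀ n₀ : ℤ, N₀ ≤ n₀ →
            ∀ (S : Fin 4 → ℤ → ℝ → ℝ) (Z : Fin 3 → ℤ → ℝ → ℝ) (E : ℤ → ℝ → ℝ),
              SplitODESystem ε₀ K ε C₁ C₂ n₀ S Z E →
              ∀ N : ℤ, n₀ ≤ N → ∀ t e : ℤ → ℝ, BlowupCheckpoints ε₀ K ε n₀ N S E t e →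
                P ε₀ K ε n₀ S Z E N t e →
                ∃ s a : ℝ, StateBounds ε₀ K ε n₀ S E (N + 1) s a ∧
                  StepBounds ε₀ K ε S E (N + 1) (t N) s (e N) a ∧
                  P ε₀ K ε n₀ S Z E (N + 1) (Function.update t (N + 1) s)
                    (Function.update e (N + 1) a)

/-- **Theorem 6.2♯ ⇐ Proposition 6.4♯ (PROVED reduction).** If, for some family `P` of asymmetry
clauses that every split solution satisfies at its datum (level `n₀`, `t ≡ 0`, `e ≡ 1`), the
inductive step `splitBlowupDynamicsStep P` holds, then the split system has no global solution in
Tao's regime (the quantifier block of `TaoCascade.noGlobalODESolution`, for `SplitODESystem`), with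
the thresholds of the step. This is the split
reading of §6.2 (last paragraph) and §6.3 ("Clearly, Proposition 6.4 implies Proposition 6.3").
[cite: Tao2016AveragedNS, §6.2–6.3 p. 32] -/
theorem noGlobalSplitODESolution_of_splitBlowupDynamicsStep
    {P : ℝ → ℝ → ℝ → ℤ → (Fin 4 → ℤ → ℝ → ℝ) → (Fin 3 → ℤ → ℝ → ℝ) → (ℤ → ℝ → ℝ) →
      ℤ → (ℤ → ℝ) → (ℤ → ℝ) → Prop}
    (hbase : ∀ (ε₀ K ε C₁ C₂ : ℝ) (n₀ : ℤ) (S : Fin 4 → ℤ → ℝ → ℝ) (Z : Fin 3 → ℤ → ℝ → ℝ)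
      (E : ℤ → ℝ → ℝ), SplitODESystem ε₀ K ε C₁ C₂ n₀ S Z E →
        P ε₀ K ε n₀ S Z E n₀ (fun _ => 0) (fun _ => 1))
    (h : splitBlowupDynamicsStep P) :
    ∀ ε₀ : ℝ, 0 < ε₀ → ε₀ < 1 →
      ∃ K₀ : ℝ, ∀ K : ℝ, K₀ ≤ K → 0 < K →
        ∃ e₀ : ℝ, 0 < e₀ ∧ ∀ ε : ℝ, 0 < ε → ε ≤ e₀ →
          ∀ C₁ C₂ : ℝ, 0 ≤ C₁ → 0 ≤ C₂ →
            ∃ N₀ : ℤ, ∀ n₀ : ℤ, N₀ ≤ n₀ →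
              ¬ ∃ (S : Fin 4 → ℤ → ℝ → ℝ) (Z : Fin 3 → ℤ → ℝ → ℝ) (E : ℤ → ℝ → ℝ),
                SplitODESystem ε₀ K ε C₁ C₂ n₀ S Z E := by
  intro ε₀ hε₀ hε₀1
  obtain ⟨K₀, hK⟩ := h ε₀ hε₀ hε₀1
  refine ⟨K₀, fun K hK₀K hKpos => ?_⟩
  obtain ⟨e₀, he₀, hε⟩ := hK K hK₀K hKpos
  refine ⟨e₀, he₀, fun ε hεpos hεle C₁ C₂ hC₁ hC₂ => ?_⟩
  obtain ⟨N₀, hN⟩ := hε ε hεpos hεle C₁ C₂ hC₁ hC₂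
  refine ⟨N₀, fun n₀ hn₀ => ?_⟩
  rintro ⟨S, Z, E, hsol⟩
  exact hsol.false_of_inductiveStep hε₀ hKpos hεpos (P ε₀ K ε n₀ S Z E)
    (hbase ε₀ K ε C₁ C₂ n₀ S Z E hsol) (hN n₀ hn₀ S Z E hsol)

end Literature.Analysis.FluidPDE.Tao2016AveragedNS
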